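import Summits.Ventures.HodgeRepro2.T5SU11JacobiTransform

/-!
# The exact domain of convergence of the spherical transform of `m_k = (1 − |g·0|²)^{k/2}`:
`∫_G m_k φ_λ dν < ∞ ⟺ λ < k ∧ k + λ > 2`

`T5SU11JacobiTransform` evaluates `∫_G m_k φ_λ dν` for `k > 1`, `λ < k`, `k + λ > 2`. Here the
convergence is shown to be SHARP: `m_k φ_λ ∈ L¹(ν)` if and only if `λ < k` and `k + λ > 2`, i.e. exactly
on the strip `|λ − 1| < k − 1` (`integrable_orbit_rpow_mul_sph_iff`, `integrable_orbit_rpow_mul_sph_iff'`).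
The divergence half rests on a LOWER bound of every spherical function by a power of `|a(g)|`:
`T5SU11SphericalLpSharp` gives `|a(g)|^{-λ} ≤ 2^λ φ_λ(g)` for `λ ≥ 0`, and for `λ ≤ 0` the Laplace
integral restricted to `|φ| ≥ π/2` (where the base is `≥ cosh 2t ≥ cosh² t`) gives
`φ_λ(a_t) ≥ (1/2)(cosh 2t)^{-λ/2} ≥ (1/2) cosh^{-λ} t` (`sph_hyp_ge_of_nonpos`,
`norm_mat_inv_rpow_le_two_mul_sph_of_nonpos`); together: **for every `λ` there is `c_λ > 0` with
`c_λ |a(g)|^{-λ} ≤ φ_λ(g)`** (`exists_mul_norm_mat_inv_rpow_le_sph`). Hence `m_k φ_λ ∈ L¹` forces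
`|a|^{-(k+λ)} ∈ L¹`, i.e. `k + λ > 2` (`T5BergmanIntegrableSharp.integrable_norm_mat_inv_rpow_iff`), and,
through the functional equation `φ_λ = φ_{2−λ}`, `|a|^{-(k+2−λ)} ∈ L¹`, i.e. `λ < k`. Nothing is claimed
about (N).

Blind lane: Mathlib + the HodgeRepro2 prefix only; no sorry; axioms ⊆ {propext, Classical.choice,
Quot.sound}.
-/

namespace Summit.Ventures.HodgeRepro2.T5SU11JacobiThreshold

open MeasureTheory MeasureTheory.Measure Metric Set Filter Topology Complex intervalIntegral
open T5SU11Unimodular T5SU11Fibration T5SU11Cartan T5SU11OneParameter T5SU11CartanProjection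
  T5HaarCircle T5BergmanCoefficient T5SU11FibrationHaar T5SU11IwasawaProjection
  T5BergmanIntegrableSharp T5SU11SphericalFunction T5SU11SphericalSymmetry T5SU11SphericalBounds
  T5SU11SphericalContinuous T5SU11SphericalLpSharp T5SU11JacobiIwasawa T5SU11JacobiTransform
open scoped Real

/-! ### A lower bound for `φ_λ` with `λ ≤ 0` -/

/-- The Laplace base is `≥ cosh 2t` where `cos φ ≤ 0` (and `t ≥ 0`). -/
lemma cosh_le_laplace_base {t φ : ℝ} (ht : 0 ≤ t) (hφ : Real.cos φ ≤ 0) :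
    Real.cosh (2 * t) ≤ Real.cosh (2 * t) - Real.sinh (2 * t) * Real.cos φ := by
  have hs : 0 ≤ Real.sinh (2 * t) := Real.sinh_nonneg_iff.mpr (by linarith)
  nlinarith [mul_nonneg hs (neg_nonneg.mpr hφ)]

/-- `m_k(g) = |a(g)|^{-k}` as real powers. -/
lemma orbit_rpow_eq_norm_mat_inv_rpow (k : ℝ) (g : SU11) :
    (1 - ‖orbit g‖ ^ 2) ^ (k / 2) = ‖mat g 0 0‖⁻¹ ^ k := by
  rw [one_sub_norm_orbit_sq, ← Real.rpow_two, ← Real.rpow_mul (inv_nonneg.mpr (norm_nonneg _))]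
  congr 1
  ring

section measure

variable [MeasurableSpace Circle] [BorelSpace Circle]

/-- **`φ_λ(a_t) ≥ (1/2) (cosh 2t)^{-λ/2}` for `λ ≤ 0` and `t ≥ 0`** (the Laplace integral over
`π/2 ≤ |φ| ≤ π`, where the base is `≥ cosh 2t`). -/
theorem sph_hyp_ge_of_nonpos {lam : ℝ} (hlam : lam ≤ 0) {t : ℝ} (ht : 0 ≤ t) :
    (1 / 2) * Real.cosh (2 * t) ^ (-lam / 2) ≤ sph lam (hyp t) := by
  have hπ := Real.pi_pos
  rw [sph_hyp_eq_laplace]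
  set f : ℝ → ℝ := fun φ => (Real.cosh (2 * t) - Real.sinh (2 * t) * Real.cos φ) ^ (-lam / 2) with hf
  have hfc : Continuous f := by
    have h1 : Continuous fun φ => Real.cosh (2 * t) - Real.sinh (2 * t) * Real.cos φ := by fun_prop
    exact h1.rpow_const fun φ => Or.inl (laplace_base_pos t φ).ne'
  have hf0 : ∀ φ, 0 ≤ f φ := fun φ => Real.rpow_nonneg (laplace_base_pos t φ).le _
  have hfeven : ∀ φ, f (-φ) = f φ := fun φ => by simp only [hf, Real.cos_neg]
  -- symmetric interval → `[0, π]`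
  have hsymm : ∫ φ in (-π)..π, f φ = 2 * ∫ φ in (0 : ℝ)..π, f φ :=
    T5SU11SphericalXiLog.integral_symm_of_even hfeven hπ.le (hfc.intervalIntegrable _ _)
  -- `[0, π]` → `[π/2, π]`
  have hsplit : ∫ φ in (0 : ℝ)..π, f φ = (∫ φ in (0 : ℝ)..(π / 2), f φ) + ∫ φ in (π / 2)..π, f φ :=
    (intervalIntegral.integral_add_adjacent_intervals (hfc.intervalIntegrable _ _)
      (hfc.intervalIntegrable _ _)).symm
  have h1 : 0 ≤ ∫ φ in (0 : ℝ)..(π / 2), f φ :=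
    intervalIntegral.integral_nonneg (by positivity) fun φ _ => hf0 φ
  -- on `[π/2, π]`: `f ≥ (cosh 2t)^{-λ/2}`
  have h2 : ∫ φ in (π / 2)..π, Real.cosh (2 * t) ^ (-lam / 2) ≤ ∫ φ in (π / 2)..π, f φ := by
    refine intervalIntegral.integral_mono_on (by linarith) intervalIntegrable_const
      (hfc.intervalIntegrable _ _) fun φ hφ => ?_
    have hcos : Real.cos φ ≤ 0 :=
      Real.cos_nonpos_of_pi_div_two_le_of_le hφ.1 (by linarith [hφ.2])
    exact Real.rpow_le_rpow (Real.cosh_pos _).le (cosh_le_laplace_base ht hcos) (by linarith)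
  rw [intervalIntegral.integral_const, smul_eq_mul, show π - π / 2 = π / 2 by ring] at h2
  rw [hsymm, hsplit]
  have hc : 0 ≤ Real.cosh (2 * t) ^ (-lam / 2) := Real.rpow_nonneg (Real.cosh_pos _).le _
  have key : π / 2 * Real.cosh (2 * t) ^ (-lam / 2) ≤
      (∫ φ in (0 : ℝ)..(π / 2), f φ) + ∫ φ in (π / 2)..π, f φ := by linarith
  calc (1 / 2) * Real.cosh (2 * t) ^ (-lam / 2)
      = (2 * π)⁻¹ * (2 * (π / 2 * Real.cosh (2 * t) ^ (-lam / 2))) := by field_simp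
    _ ≤ (2 * π)⁻¹ * (2 * ((∫ φ in (0 : ℝ)..(π / 2), f φ) + ∫ φ in (π / 2)..π, f φ)) := by
        gcongr

/-- **`|a(g)|^{-λ} ≤ 2 φ_λ(g)` for `λ ≤ 0`** (`cosh 2T ≥ cosh² T`, `T = cartanT g`, `|a| = cosh T`). -/
theorem norm_mat_inv_rpow_le_two_mul_sph_of_nonpos {lam : ℝ} (hlam : lam ≤ 0) (g : SU11) :
    ‖mat g 0 0‖⁻¹ ^ lam ≤ 2 * sph lam g := by
  have hT := cartanT_nonneg g
  have h := sph_hyp_ge_of_nonpos hlam hT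
  rw [← sph_eq_sph_hyp_cartanT] at h
  have hc : 0 < Real.cosh (cartanT g) := Real.cosh_pos _
  have h2 : Real.cosh (cartanT g) ^ 2 ≤ Real.cosh (2 * cartanT g) := by
    rw [Real.cosh_two_mul]
    nlinarith [Real.one_le_cosh (cartanT g)]
  have h3 : (Real.cosh (cartanT g) ^ 2) ^ (-lam / 2) ≤ Real.cosh (2 * cartanT g) ^ (-lam / 2) :=
    Real.rpow_le_rpow (by positivity) h2 (by linarith)
  have h4 : ‖mat g 0 0‖⁻¹ ^ lam = (Real.cosh (cartanT g) ^ 2) ^ (-lam / 2) := by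
    rw [← cosh_cartanT, ← Real.rpow_two, ← Real.rpow_mul hc.le, Real.inv_rpow hc.le,
      ← Real.rpow_neg hc.le]
    congr 1
    ring
  rw [h4]
  linarith

/-- **For every `λ` there is `c_λ > 0` with `c_λ |a(g)|^{-λ} ≤ φ_λ(g)`** (`c_λ = 2^{-λ}` for `λ ≥ 0`,
`c_λ = 1/2` for `λ ≤ 0`). -/
theorem exists_mul_norm_mat_inv_rpow_le_sph (lam : ℝ) :
    ∃ c : ℝ, 0 < c ∧ ∀ g : SU11, c * ‖mat g 0 0‖⁻¹ ^ lam ≤ sph lam g := by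
  rcases le_or_gt 0 lam with h | h
  · refine ⟨(2 : ℝ) ^ (-lam), Real.rpow_pos_of_pos two_pos _, fun g => ?_⟩
    have h1 := norm_mat_inv_rpow_le_sph h g
    have h2 : (0 : ℝ) < 2 ^ lam := Real.rpow_pos_of_pos two_pos _
    rw [Real.rpow_neg (by norm_num), inv_mul_le_iff₀ h2]
    exact h1
  · refine ⟨1 / 2, by norm_num, fun g => ?_⟩
    have := norm_mat_inv_rpow_le_two_mul_sph_of_nonpos h.le g
    linarith

/-! ### The exact domain of convergence -/

/-- If `m_k φ_λ ∈ L¹(ν)` then `k + λ > 2`. -/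
theorem two_lt_add_of_integrable {k lam : ℝ}
    (h : Integrable (fun g => (1 - ‖orbit g‖ ^ 2) ^ (k / 2) * sph lam g) (nu haarCircle)) :
    2 < k + lam := by
  obtain ⟨c, hc, hcs⟩ := exists_mul_norm_mat_inv_rpow_le_sph lam
  rw [← integrable_norm_mat_inv_rpow_iff (nu haarCircle)]
  refine (h.const_mul c⁻¹).mono' (continuous_norm_mat_inv_rpow _).aestronglyMeasurable
    (Filter.Eventually.of_forall fun g => ?_)
  have hpos : 0 < ‖mat g 0 0‖⁻¹ :=
    inv_pos.mpr (norm_pos_iff.mpr (T5SU11KProjection.mat_zero_zero_ne_zero g))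
  rw [Real.norm_eq_abs, abs_of_nonneg (Real.rpow_nonneg hpos.le _), Real.rpow_add hpos,
    orbit_rpow_eq_norm_mat_inv_rpow]
  have h1 : ‖mat g 0 0‖⁻¹ ^ lam ≤ c⁻¹ * sph lam g := by
    rw [le_inv_mul_iff₀ hc]
    exact hcs g
  calc ‖mat g 0 0‖⁻¹ ^ k * ‖mat g 0 0‖⁻¹ ^ lam
      ≤ ‖mat g 0 0‖⁻¹ ^ k * (c⁻¹ * sph lam g) :=
        mul_le_mul_of_nonneg_left h1 (Real.rpow_nonneg hpos.le _)
    _ = c⁻¹ * (‖mat g 0 0‖⁻¹ ^ k * sph lam g) := by ring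

/-- If `m_k φ_λ ∈ L¹(ν)` then `λ < k` (the functional equation `φ_λ = φ_{2−λ}`). -/
theorem lt_of_integrable {k lam : ℝ}
    (h : Integrable (fun g => (1 - ‖orbit g‖ ^ 2) ^ (k / 2) * sph lam g) (nu haarCircle)) :
    lam < k := by
  have e : (fun g => (1 - ‖orbit g‖ ^ 2) ^ (k / 2) * sph lam g)
      = fun g => (1 - ‖orbit g‖ ^ 2) ^ (k / 2) * sph (2 - lam) g := by
    funext g
    rw [sph_two_sub lam g]
  rw [e] at h
  have := two_lt_add_of_integrable h
  linarith

/-- **THE EXACT DOMAIN OF CONVERGENCE**: `m_k φ_λ ∈ L¹(ν) ⟺ λ < k ∧ k + λ > 2`. -/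
theorem integrable_orbit_rpow_mul_sph_iff (k lam : ℝ) :
    Integrable (fun g => (1 - ‖orbit g‖ ^ 2) ^ (k / 2) * sph lam g) (nu haarCircle)
      ↔ (lam < k ∧ 2 < k + lam) := by
  constructor
  · intro h
    exact ⟨lt_of_integrable h, two_lt_add_of_integrable h⟩
  · rintro ⟨h1, h2⟩
    exact integrable_orbit_rpow_mul_sph (by linarith) h1 h2

/-- The same as a strip around the critical parameter: `m_k φ_λ ∈ L¹(ν) ⟺ |λ − 1| < k − 1`. -/
theorem integrable_orbit_rpow_mul_sph_iff' (k lam : ℝ) :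
    Integrable (fun g => (1 - ‖orbit g‖ ^ 2) ^ (k / 2) * sph lam g) (nu haarCircle)
      ↔ |lam - 1| < k - 1 := by
  rw [integrable_orbit_rpow_mul_sph_iff, abs_sub_lt_iff]
  constructor <;> rintro ⟨h1, h2⟩ <;> exact ⟨by linarith, by linarith⟩

/-- **The `Ξ`-threshold**: `m_k Ξ ∈ L¹(ν) ⟺ k > 1` (while `m_k ∈ L¹(ν) ⟺ k > 2`). -/
theorem integrable_orbit_rpow_mul_sph_one_iff (k : ℝ) :
    Integrable (fun g => (1 - ‖orbit g‖ ^ 2) ^ (k / 2) * sph 1 g) (nu haarCircle) ↔ 1 < k := by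
  rw [integrable_orbit_rpow_mul_sph_iff]
  constructor
  · rintro ⟨h1, _⟩
    exact h1
  · intro h
    exact ⟨h, by linarith⟩

/-- **Divergence**: `m_k φ_λ ∉ L¹(ν)` when `k ≤ λ` or `k + λ ≤ 2`. -/
theorem not_integrable_orbit_rpow_mul_sph {k lam : ℝ} (h : k ≤ lam ∨ k + lam ≤ 2) :
    ¬ Integrable (fun g => (1 - ‖orbit g‖ ^ 2) ^ (k / 2) * sph lam g) (nu haarCircle) := by
  rw [integrable_orbit_rpow_mul_sph_iff]
  rintro ⟨h1, h2⟩
  rcases h with h | h <;> linarith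

end measure

end Summit.Ventures.HodgeRepro2.T5SU11JacobiThreshold
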